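import Mathlib
import Literature.Analysis.FluidPDE.LocalPressureOscillation
import HarnessLib.Audit
import HarnessLib

/-!
# L3TimeExponentPincer — ring datum calculus VIII: sup × volume bounds on `ℝ³`

Support kernel for the crux `L3CascadeJaw` (item stmt-NavierStokesRegularity-19499): the
measure-theoretic bookkeeping that turns the POINTWISE bounds on the ring datum
(`…RingDatumEta`: `|ω_θ/r| ≤ M`, support in a ball; `…RingDatumVelocity`: `‖u₀‖² ≥ e₀` on a small
ball) into the INTEGRAL hypotheses of `lpPersistence_of_ringData` (`∫|η₀| ≤ m`, `∫⁻ η₀⁻ ≤ mneg`,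
`∫⁻ r²η₀^± ≤ P`, `ofReal E ≤ ∫⁻ ‖u₀‖ₑ²`) WITHOUT computing any radial integral: only
`volume (ball x r) = r³ · volume (ball 0 1)` (`Measure.addHaar_ball`) and monotonicity.
`V₁ := (volume (ball (0 : ℝ³) 1)).toReal ∈ (0, ∞)` is carried as a letter.

* `volume_closedBall_three` — scaling of closed balls in `ℝ³` (balls: tree
  `Literature.Analysis.FluidPDE.volume_ball_eq_ofReal_mul`); `volume_ball_ne_top` — `V₁ < ∞`
  (positivity: tree `…WeakL3Reach.volume_unitBall_toReal_pos`);
* `lintegral_ofReal_le_of_le_of_support` — `g ≤ C`, `g ≤ 0` off `closedBall 0 ρ` ⇒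
  `∫⁻ ofReal g ≤ ofReal (C ρ³ V₁)`;
* `integral_abs_le_of_le_of_support` — the Bochner form `∫|g| ≤ C ρ³ V₁`;
* `ofReal_le_lintegral_of_le_on_ball` — `e₀ ≤ f` on `ball z r₀` ⇒ `ofReal (e₀ r₀³ V₁) ≤ ∫⁻ f`.

WHAT THIS IS NOT: measure-theory bookkeeping only.
-/

namespace Summit.NavierStokesRegularity.NavierStokesRegularity.Theorems.L3TimeExponentPincerRingDatumMeasure

open Real Set Metric MeasureTheory
open scoped ENNReal

/-- `volume (closedBall x r) = ofReal (r³) · volume (ball 0 1)` (`0 ≤ r`). -/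
theorem volume_closedBall_three (x : EuclideanSpace ℝ (Fin 3)) {r : ℝ} (hr : 0 ≤ r) :
    volume (closedBall x r) =
      ENNReal.ofReal (r ^ 3) * volume (ball (0 : EuclideanSpace ℝ (Fin 3)) 1) := by
  rw [Measure.addHaar_closedBall volume x hr, finrank_euclideanSpace_fin]

/-- The unit ball of `ℝ³` has finite volume. -/
theorem volume_ball_ne_top : volume (ball (0 : EuclideanSpace ℝ (Fin 3)) 1) ≠ ∞ :=
  measure_ball_lt_top.ne

/-- `volume (ball 0 1) = ofReal V₁`. -/
theorem volume_ball_eq_ofReal :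
    volume (ball (0 : EuclideanSpace ℝ (Fin 3)) 1) =
      ENNReal.ofReal (volume (ball (0 : EuclideanSpace ℝ (Fin 3)) 1)).toReal :=
  (ENNReal.ofReal_toReal volume_ball_ne_top).symm

/-- **Sup × volume bound (lintegral form)**: if `g ≤ C` everywhere (`0 ≤ C`) and `g ≤ 0` off the
closed ball of radius `ρ ≥ 0` about the origin, then `∫⁻ ofReal (g x) ≤ ofReal (C ρ³ V₁)`. -/
theorem lintegral_ofReal_le_of_le_of_support {g : EuclideanSpace ℝ (Fin 3) → ℝ} {C ρ : ℝ}
    (hC : 0 ≤ C) (hρ : 0 ≤ ρ) (hg : ∀ x, g x ≤ C) (hg0 : ∀ x, ρ < ‖x‖ → g x ≤ 0) :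
    ∫⁻ x, ENNReal.ofReal (g x) ≤
      ENNReal.ofReal (C * ρ ^ 3 * (volume (ball (0 : EuclideanSpace ℝ (Fin 3)) 1)).toReal) := by
  have hle : ∀ x, ENNReal.ofReal (g x) ≤
      (closedBall (0 : EuclideanSpace ℝ (Fin 3)) ρ).indicator (fun _ => ENNReal.ofReal C) x := by
    intro x
    by_cases hx : x ∈ closedBall (0 : EuclideanSpace ℝ (Fin 3)) ρ
    · rw [indicator_of_mem hx]; exact ENNReal.ofReal_le_ofReal (hg x)
    · rw [indicator_of_notMem hx]
      rw [mem_closedBall, dist_zero_right, not_le] at hx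
      rw [ENNReal.ofReal_of_nonpos (hg0 x hx)]
  calc ∫⁻ x, ENNReal.ofReal (g x)
      ≤ ∫⁻ x, (closedBall (0 : EuclideanSpace ℝ (Fin 3)) ρ).indicator (fun _ => ENNReal.ofReal C) x :=
        lintegral_mono hle
    _ = ENNReal.ofReal C * volume (closedBall (0 : EuclideanSpace ℝ (Fin 3)) ρ) := by
        rw [lintegral_indicator measurableSet_closedBall, setLIntegral_const]
    _ = ENNReal.ofReal (C * ρ ^ 3 * (volume (ball (0 : EuclideanSpace ℝ (Fin 3)) 1)).toReal) := by
        rw [volume_closedBall_three 0 hρ, ENNReal.ofReal_mul (by positivity : (0 : ℝ) ≤ C * ρ ^ 3),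
          ENNReal.ofReal_mul hC, ENNReal.ofReal_toReal volume_ball_ne_top, mul_assoc]

/-- **Sup × volume bound (Bochner form)**: for an a.e.-strongly measurable `g` with `|g| ≤ C` and
`g = 0` off the closed ball of radius `ρ`, `∫ |g| ≤ C ρ³ V₁`. -/
theorem integral_abs_le_of_le_of_support {g : EuclideanSpace ℝ (Fin 3) → ℝ} {C ρ : ℝ}
    (hgm : AEStronglyMeasurable g volume) (hC : 0 ≤ C) (hρ : 0 ≤ ρ) (hg : ∀ x, |g x| ≤ C)
    (hg0 : ∀ x, ρ < ‖x‖ → g x = 0) :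
    ∫ x, |g x| ≤ C * ρ ^ 3 * (volume (ball (0 : EuclideanSpace ℝ (Fin 3)) 1)).toReal := by
  have h := lintegral_ofReal_le_of_le_of_support (g := fun x => |g x|) hC hρ hg
    (fun x hx => by rw [hg0 x hx, abs_zero])
  rw [integral_eq_lintegral_of_nonneg_ae (Filter.Eventually.of_forall fun x => abs_nonneg _)
    (continuous_abs.comp_aestronglyMeasurable hgm)]
  refine ((ENNReal.toReal_le_toReal (ne_top_of_le_ne_top ENNReal.ofReal_ne_top h)
    ENNReal.ofReal_ne_top).2 h).trans ?_
  rw [ENNReal.toReal_ofReal (by positivity)]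

/-- **Lower bound from a small ball**: if `ofReal e₀ ≤ f` on `ball z r₀` (`0 ≤ e₀`, `0 ≤ r₀`) then
`ofReal (e₀ r₀³ V₁) ≤ ∫⁻ f`. -/
theorem ofReal_le_lintegral_of_le_on_ball {f : EuclideanSpace ℝ (Fin 3) → ℝ≥0∞}
    (z : EuclideanSpace ℝ (Fin 3)) {e₀ r₀ : ℝ} (he : 0 ≤ e₀) (hr : 0 ≤ r₀)
    (hf : ∀ x ∈ ball z r₀, ENNReal.ofReal e₀ ≤ f x) :
    ENNReal.ofReal (e₀ * r₀ ^ 3 * (volume (ball (0 : EuclideanSpace ℝ (Fin 3)) 1)).toReal) ≤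
      ∫⁻ x, f x := by
  calc ENNReal.ofReal (e₀ * r₀ ^ 3 * (volume (ball (0 : EuclideanSpace ℝ (Fin 3)) 1)).toReal)
      = ENNReal.ofReal e₀ * volume (ball z r₀) := by
        rw [Literature.Analysis.FluidPDE.volume_ball_eq_ofReal_mul z hr, ENNReal.ofReal_mul (by positivity : (0 : ℝ) ≤ e₀ * r₀ ^ 3),
          ENNReal.ofReal_mul he, ENNReal.ofReal_toReal volume_ball_ne_top, mul_assoc]
    _ = ∫⁻ x in ball z r₀, ENNReal.ofReal e₀ := by rw [setLIntegral_const]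
    _ ≤ ∫⁻ x in ball z r₀, f x := setLIntegral_mono' measurableSet_ball hf
    _ ≤ ∫⁻ x, f x := setLIntegral_le_lintegral _ _

end Summit.NavierStokesRegularity.NavierStokesRegularity.Theorems.L3TimeExponentPincerRingDatumMeasure
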